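import Mathlib
import Summits.MatrixMultiplication.MatrixMultiplication.Theorems.FidelityWitnessesDiagonalPowerDecayStubNonnegFlatDecayTightness

/-!
# Finite refutability of `stub_nonnegFlatDecay` made kernel-precise: ONE certified point caps δ; a maximal-mass point kills
# (line `unit-tensor-orbit-nuclear-ratio`, crux `FidelityWitnesses.DiagonalPowerDecay`, stmt-MatrixMultiplication-14053)

Lead prover-line-stmt-MatrixMultiplication-14053-1.  The open stub at a witness `(c, δ)` is `NonnegFlatDecayBody c δ`
(Objects file).  THIS FILE proves the GENERAL TRANSFER behind the Strassen cap of `…Tightness.lean`: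

* `delta_le_of_point` — if `Y` is a `0/1` FLAT tensor on a finite format `β` (`N = |β| ≥ 2`) lying in the CLOSURE of the open
  `GL³`-orbit of the unit tensor (i.e. of border rank `≤ N`) with `‖Y‖² = ρ > 0`, then every witness has
  `δ ≤ 3/2 − log_N ρ`.  (Strassen: `N = 4`, `ρ = 6`.)  Registered def-free as `nonnegFlatDecay_delta_le_of_point`.
* `not_nonnegFlatDecay_of_maxMassPoint` — hence ONE such point with MAXIMAL mass `ρ = N^{3/2}` (necessarily `N = m²`,
  `Y` with `m³` ones) refutes the stub outright: **the exact-kill criterion** ("a maximal-mass flat 0/1 tensor of minimal border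
  rank") — registered def-free as `nonnegFlatDecay_false_of_maxMassPoint`; its hypothesis is a finite, computable search target
  (kit j016908 enumerates `N = 4`).

Proof.  Kronecker powers on the format `Fin j → β` (`gkpow`, `gmpow`: the `Fin 4` objects of the Objects file with a general
base): powers of `0/1` flat tensors are `0/1` and flat (`flat_kron` + `flat_reindex` of the Tightness file), `‖Y^{⊠j}‖² = ρ^j`,
powers of open-orbit points are open-orbit points (`gmpow_mul`, `Matrix.mul_nonsing_inv`), and `T ↦ T^{⊠j}` is continuous; a
sequence of orbit points `u_n → Y` (`mem_closure_iff_seq_limit`) gives orbit points `u_n^{⊠j} → Y^{⊠j}`, the stub on them passes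
to the limit: `(ρ^j)² ≤ c (N^j)^{3/2−δ} ρ^j`, so `ρ^j ≤ c (N^{3/2−δ})^j` for all `j`, `ρ ≤ N^{3/2−δ}`, `log_N ρ ≤ 3/2 − δ`.
No facts assumed.
-/

-- the tree's namespace `Summit.MatrixMultiplication.MatrixMultiplication.…` repeats a component by design
set_option linter.dupNamespace false

noncomputable section

namespace Summit.MatrixMultiplication.MatrixMultiplication.Theorems.DiagonalPowerDecay

namespace NonnegFlatTightness

open scoped BigOperators
open Filter Topology

section General

variable {β : Type} [Fintype β] [DecidableEq β]

/-! ## Kronecker powers over a general base format `β` (format `Fin j → β`, `|ι| = |β|^j`) -/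

/-- Kronecker power of a `β`-tensor: `T^{⊠j} a b c = ∏_s T (a s) (b s) (c s)`. -/
def gkpow (T : β → β → β → ℂ) (j : ℕ) (a b c : Fin j → β) : ℂ := ∏ s, T (a s) (b s) (c s)

/-- Kronecker power of a `β × β` matrix: `M^{⊗j} a l = ∏_s M (a s) (l s)`. -/
def gmpow (M : Matrix β β ℂ) (j : ℕ) : Matrix (Fin j → β) (Fin j → β) ℂ := fun a l => ∏ s, M (a s) (l s)

omit [DecidableEq β] in
/-- `|Fin j → β| = |β|^j`. -/
theorem card_gformat (j : ℕ) : Fintype.card (Fin j → β) = Fintype.card β ^ j := by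
  simp

omit [DecidableEq β] in
/-- Kronecker powers of matrices multiply factorwise. -/
theorem gmpow_mul (M M' : Matrix β β ℂ) (j : ℕ) : gmpow M j * gmpow M' j = gmpow (M * M') j := by
  ext a l
  simp only [Matrix.mul_apply, gmpow, ← Finset.prod_mul_distrib]
  rw [Fintype.prod_sum]

omit [Fintype β] in
/-- The Kronecker power of the identity is the identity. -/
theorem gmpow_one (j : ℕ) : gmpow (1 : Matrix β β ℂ) j = 1 := by
  ext a l
  simp only [gmpow, Matrix.one_apply]
  by_cases h : a = l
  · subst h; simp
  · obtain ⟨s, hs⟩ : ∃ s, a s ≠ l s := Function.ne_iff.mp h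
    rw [if_neg h]
    exact Finset.prod_eq_zero (Finset.mem_univ s) (if_neg hs)

/-- Kronecker powers of invertible matrices are invertible. -/
theorem isUnit_det_gmpow {M : Matrix β β ℂ} (h : IsUnit M.det) (j : ℕ) : IsUnit (gmpow M j).det :=
  Matrix.isUnit_det_of_right_inverse (B := gmpow M⁻¹ j) (by rw [gmpow_mul, Matrix.mul_nonsing_inv M h, gmpow_one])

omit [DecidableEq β] in
/-- The orbit point of a Kronecker-power frame is the Kronecker power of the orbit point. -/
theorem orbit_gmpow (A B C : Matrix β β ℂ) (j : ℕ) (a b c : Fin j → β) :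
    (∑ L, gmpow A j a L * gmpow B j b L * gmpow C j c L) =
      gkpow (fun i i' k => ∑ l, A i l * B i' l * C k l) j a b c := by
  simp only [gmpow, gkpow, ← Finset.prod_mul_distrib]
  rw [Fintype.prod_sum]

omit [Fintype β] [DecidableEq β] in
/-- Peeling off coordinate `0`. -/
theorem gkpow_succ (T : β → β → β → ℂ) (j : ℕ) (a b c : Fin (j + 1) → β) :
    gkpow T (j + 1) a b c = T (a 0) (b 0) (c 0) * gkpow T j (Fin.tail a) (Fin.tail b) (Fin.tail c) :=
  Fin.prod_univ_succ _

omit [Fintype β] [DecidableEq β] in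
/-- Kronecker powers of `0/1` tensors are `0/1`. -/
theorem zeroOne_gkpow {T : β → β → β → ℂ} (hT : ZeroOne T) : ∀ j, ZeroOne (gkpow T j) := by
  intro j
  induction j with
  | zero => intro a b c; right; simp [gkpow]
  | succ j ih =>
    intro a b c
    rw [gkpow_succ]
    rcases hT (a 0) (b 0) (c 0) with h0 | h1
    · left; rw [h0, zero_mul]
    · rcases ih (Fin.tail a) (Fin.tail b) (Fin.tail c) with h0' | h1'
      · left; rw [h0', mul_zero]
      · right; rw [h1, h1', mul_one]

omit [DecidableEq β] in
/-- The empty power (constant `1` on the one-point format) is flat. -/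
theorem flat_gkpow_zero (T : β → β → β → ℂ) : Flat (gkpow T 0) := by
  intro w u v
  simp only [gkpow, Finset.univ_eq_empty, Finset.prod_empty, mul_one,
    Finset.univ_unique, Finset.sum_singleton]
  rw [Real.sqrt_sq (norm_nonneg _), Real.sqrt_sq (norm_nonneg _), Real.sqrt_sq (norm_nonneg _),
    norm_mul, norm_mul]

omit [DecidableEq β] in
/-- Kronecker powers of a `0/1` flat tensor are flat. -/
theorem flat_gkpow {T : β → β → β → ℂ} (h01 : ZeroOne T) (hT : Flat T) : ∀ j, Flat (gkpow T j) := by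
  intro j
  induction j with
  | zero => exact flat_gkpow_zero T
  | succ j ih =>
    have hk := flat_kron (nonneg_of_zeroOne h01) hT ih
    have hr := flat_reindex (Fin.consEquiv (fun _ : Fin (j + 1) => β)).symm hk
    have heq : gkpow T (j + 1) = fun a b c : Fin (j + 1) → β =>
        (fun x y z : β × (Fin j → β) => T x.1 y.1 z.1 * gkpow T j x.2 y.2 z.2)
          ((Fin.consEquiv (fun _ : Fin (j + 1) => β)).symm a)
          ((Fin.consEquiv (fun _ : Fin (j + 1) => β)).symm b)
          ((Fin.consEquiv (fun _ : Fin (j + 1) => β)).symm c) := by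
      funext a b c
      rw [gkpow_succ]
      simp [Fin.consEquiv]
    rw [heq]
    exact hr

omit [DecidableEq β] in
/-- `‖T^{⊠j}‖² = (‖T‖²)^j`. -/
theorem normSq_gkpow (T : β → β → β → ℂ) (j : ℕ) :
    (∑ a, ∑ b, ∑ c, ‖gkpow T j a b c‖ ^ 2) = (∑ i, ∑ i', ∑ k, ‖T i i' k‖ ^ 2) ^ j := by
  induction j with
  | zero =>
    simp [gkpow, Finset.univ_unique]
  | succ j ih =>
    have heq : ∀ a b c : Fin (j + 1) → β, ‖gkpow T (j + 1) a b c‖ ^ 2 =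
        (fun x y z : β × (Fin j → β) => ‖T x.1 y.1 z.1‖ ^ 2 * ‖gkpow T j x.2 y.2 z.2‖ ^ 2)
          ((Fin.consEquiv (fun _ : Fin (j + 1) => β)).symm a)
          ((Fin.consEquiv (fun _ : Fin (j + 1) => β)).symm b)
          ((Fin.consEquiv (fun _ : Fin (j + 1) => β)).symm c) := by
      intro a b c
      rw [gkpow_succ, norm_mul, mul_pow]
      simp [Fin.consEquiv]
    simp only [heq]
    rw [sum_reindex3 (Fin.consEquiv (fun _ : Fin (j + 1) => β)).symm
      (fun x y z : β × (Fin j → β) => ‖T x.1 y.1 z.1‖ ^ 2 * ‖gkpow T j x.2 y.2 z.2‖ ^ 2)]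
    rw [sum3_prod, pow_succ, ← ih]
    simp only [Finset.mul_sum, Finset.sum_mul]
    refine Finset.sum_congr rfl fun a _ => Finset.sum_congr rfl fun b _ =>
      Finset.sum_congr rfl fun c _ => Finset.sum_congr rfl fun a' _ =>
      Finset.sum_congr rfl fun b' _ => Finset.sum_congr rfl fun c' _ => ?_
    ring

omit [Fintype β] [DecidableEq β] in
/-- `T ↦ T^{⊠j} a b c` is continuous (a finite product of coordinate evaluations). -/
theorem continuous_gkpow (j : ℕ) (a b c : Fin j → β) :
    Continuous fun T : β → β → β → ℂ => gkpow T j a b c := by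
  unfold gkpow
  refine continuous_finsetProd _ fun s _ => ?_
  fun_prop

/-! ## The open orbit and its Kronecker powers -/

/-- The open `GL³`-orbit of the unit tensor on the format `β` (as in the registered stub, unfolded). -/
def orbitSet (β : Type) [Fintype β] [DecidableEq β] : Set (β → β → β → ℂ) :=
  {S' | ∃ A B C : Matrix β β ℂ, IsUnit A.det ∧ IsUnit B.det ∧ IsUnit C.det ∧
    S' = fun a b c => ∑ l, A a l * B b l * C c l}

/-- Kronecker powers of open-orbit points are open-orbit points of the power format. -/
theorem gkpow_mem_orbitSet {S : β → β → β → ℂ} (hS : S ∈ orbitSet β) (j : ℕ) :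
    gkpow S j ∈ orbitSet (Fin j → β) := by
  obtain ⟨A, B, C, hA, hB, hC, rfl⟩ := hS
  refine ⟨gmpow A j, gmpow B j, gmpow C j, isUnit_det_gmpow hA j, isUnit_det_gmpow hB j,
    isUnit_det_gmpow hC j, ?_⟩
  funext a b c
  exact (orbit_gmpow A B C j a b c).symm

/-! ## The point cap -/

/-- **One certified point caps δ.**  If `Y` is `0/1`, flat, in the closure of the open orbit of the unit tensor on a format
`β` with `|β| ≥ 2`, and `‖Y‖² = ρ > 0`, then every witness `(c, δ)` of the stub has `δ ≤ 3/2 − log_{|β|} ρ`. -/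
theorem delta_le_of_point {c δ : ℝ} (h : NonnegFlatDecayBody c δ) {Y : β → β → β → ℂ} (h01 : ZeroOne Y)
    (hflat : Flat Y) (hcl : Y ∈ closure (orbitSet β)) (hcard : 2 ≤ Fintype.card β)
    (hpos : 0 < ∑ a, ∑ b, ∑ c', ‖Y a b c'‖ ^ 2) :
    δ ≤ 3 / 2 - Real.logb (Fintype.card β) (∑ a, ∑ b, ∑ c', ‖Y a b c'‖ ^ 2) := by
  set N : ℝ := (Fintype.card β : ℝ) with hN
  set ρ : ℝ := ∑ a, ∑ b, ∑ c', ‖Y a b c'‖ ^ 2 with hρ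
  have hN1 : (1 : ℝ) < N := by rw [hN]; exact_mod_cast hcard
  have hN0 : (0 : ℝ) ≤ N := by linarith
  -- a sequence of orbit points converging to `Y`
  obtain ⟨u, hu_mem, hu_lim⟩ := mem_closure_iff_seq_limit.mp hcl
  -- Step 1: for every `j`, `ρ^j ≤ c · (N^{3/2-δ})^j`
  have key : ∀ j : ℕ, ρ ^ j ≤ c * (N ^ ((3 : ℝ) / 2 - δ)) ^ j := by
    intro j
    have hY01 : ZeroOne (gkpow Y j) := zeroOne_gkpow h01 j
    have hYflat : Flat (gkpow Y j) := flat_gkpow h01 hflat j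
    have hnormSq : (∑ a, ∑ b, ∑ c', ‖gkpow Y j a b c'‖ ^ 2) = ρ ^ j := by rw [normSq_gkpow]
    -- the stub on the orbit points `(u n)^{⊠j}`
    have horb : ∀ n : ℕ,
        ‖∑ a, ∑ b, ∑ c', gkpow (u n) j a b c' * gkpow Y j a b c'‖ ^ 2 ≤
          c * (N ^ j) ^ ((3 : ℝ) / 2 - δ) * ∑ a, ∑ b, ∑ c', ‖gkpow (u n) j a b c'‖ ^ 2 := by
      intro n
      obtain ⟨A, B, C, hA, hB, hC, hEq⟩ := gkpow_mem_orbitSet (hu_mem n) j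
      have hb := h (Fin j → β) (gkpow Y j) (nonneg_of_zeroOne hY01) hYflat A B C hA hB hC
      have hEq' : ∀ a b c' : Fin j → β, (∑ l, A a l * B b l * C c' l) = gkpow (u n) j a b c' :=
        fun a b c' => (congrFun (congrFun (congrFun hEq a) b) c').symm
      simp only [hEq', card_gformat] at hb
      push_cast at hb
      exact hb
    -- pass to the limit `n → ∞`
    have hf : Continuous fun T : β → β → β → ℂ =>
        ‖∑ a, ∑ b, ∑ c', gkpow T j a b c' * gkpow Y j a b c'‖ ^ 2 :=
      ((continuous_finsetSum _ fun a _ => continuous_finsetSum _ fun b _ =>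
        continuous_finsetSum _ fun c' _ => (continuous_gkpow j a b c').mul continuous_const).norm).pow 2
    have hg : Continuous fun T : β → β → β → ℂ =>
        c * (N ^ j) ^ ((3 : ℝ) / 2 - δ) * ∑ a, ∑ b, ∑ c', ‖gkpow T j a b c'‖ ^ 2 :=
      continuous_const.mul (continuous_finsetSum _ fun a _ => continuous_finsetSum _ fun b _ =>
        continuous_finsetSum _ fun c' _ => ((continuous_gkpow j a b c').norm).pow 2)
    have hlim := le_of_tendsto_of_tendsto ((hf.tendsto Y).comp hu_lim) ((hg.tendsto Y).comp hu_lim)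
      (Eventually.of_forall fun n => horb n)
    -- evaluate: `(ρ^j)² ≤ c (N^j)^{3/2-δ} ρ^j`
    rw [overlap_self_of_zeroOne hY01, Complex.norm_real, Real.norm_of_nonneg (by positivity), hnormSq,
      rpow_natPow_comm hN0] at hlim
    have hρj : (0 : ℝ) < ρ ^ j := pow_pos hpos j
    rw [sq] at hlim
    exact le_of_mul_le_mul_right hlim hρj
  -- Step 2: `ρ ≤ N^{3/2-δ}`, i.e. `logb N ρ ≤ 3/2 - δ`
  have hle : ρ ≤ N ^ ((3 : ℝ) / 2 - δ) :=
    le_of_pow_le_mul_pow (Real.rpow_pos_of_pos (by linarith) _) key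
  have hlog : Real.logb N ρ ≤ 3 / 2 - δ := (Real.logb_le_iff_le_rpow hN1 hpos).mpr hle
  linarith

/-- **The exact-kill criterion.**  A `0/1` flat tensor of MAXIMAL mass `‖Y‖² = |β|^{3/2}` in the closure of the open orbit
of the unit tensor (`|β| ≥ 2`) refutes the stub at every `δ > 0`. -/
theorem not_body_of_maxMassPoint {Y : β → β → β → ℂ} (h01 : ZeroOne Y) (hflat : Flat Y)
    (hcl : Y ∈ closure (orbitSet β)) (hcard : 2 ≤ Fintype.card β)
    (hmass : (∑ a, ∑ b, ∑ c', ‖Y a b c'‖ ^ 2) = (Fintype.card β : ℝ) ^ ((3 : ℝ) / 2))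
    {c δ : ℝ} (hδ : 0 < δ) : ¬ NonnegFlatDecayBody c δ := by
  intro h
  have hN1 : (1 : ℝ) < (Fintype.card β : ℝ) := by exact_mod_cast hcard
  have hpos : 0 < ∑ a, ∑ b, ∑ c', ‖Y a b c'‖ ^ 2 := by
    rw [hmass]; exact Real.rpow_pos_of_pos (by linarith) _
  have hcap := delta_le_of_point h h01 hflat hcl hcard hpos
  rw [hmass, Real.logb_rpow (by linarith) hN1.ne'] at hcap
  linarith

end General

end NonnegFlatTightness

open scoped BigOperators

/-- **Registered sub-goal `nonnegFlatDecay_delta_le_of_point` (def-free): one certified point caps δ.**  For a `0/1` flat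
tensor `Y` on a finite format `β` (`|β| ≥ 2`) in the closure of the open `GL³`-orbit of the unit tensor with `‖Y‖² > 0`, every
witness `(c, δ)` of `stub_nonnegFlatDecay` has `δ ≤ 3/2 − logb |β| ‖Y‖²`. -/
theorem nonnegFlatDecay_delta_le_of_point :
    ∀ (β : Type) [Fintype β] [DecidableEq β] (Y : β → β → β → ℂ), 2 ≤ Fintype.card β →
      (∀ i j k, Y i j k = 0 ∨ Y i j k = 1) →
      (∀ w u v : β → ℂ, ‖∑ i, ∑ j, ∑ k, w i * u j * v k * Y i j k‖ ≤
        Real.sqrt (∑ i, ‖w i‖ ^ 2) * Real.sqrt (∑ j, ‖u j‖ ^ 2) * Real.sqrt (∑ k, ‖v k‖ ^ 2)) →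
      Y ∈ closure {S' : β → β → β → ℂ | ∃ A B C : Matrix β β ℂ,
        IsUnit A.det ∧ IsUnit B.det ∧ IsUnit C.det ∧ S' = fun a b c => ∑ l, A a l * B b l * C c l} →
      0 < ∑ i, ∑ j, ∑ k, ‖Y i j k‖ ^ 2 →
      ∀ c δ : ℝ, (∀ (ι : Type) [Fintype ι] [DecidableEq ι] (Y' : ι → ι → ι → ℂ),
        (∀ i j k, ∃ t : ℝ, 0 ≤ t ∧ Y' i j k = t) →
        (∀ w u v : ι → ℂ, ‖∑ i, ∑ j, ∑ k, w i * u j * v k * Y' i j k‖ ≤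
          Real.sqrt (∑ i, ‖w i‖ ^ 2) * Real.sqrt (∑ j, ‖u j‖ ^ 2) * Real.sqrt (∑ k, ‖v k‖ ^ 2)) →
        ∀ (A B C : Matrix ι ι ℂ), IsUnit A.det → IsUnit B.det → IsUnit C.det →
          ‖∑ i, ∑ j, ∑ k, (∑ l, A i l * B j l * C k l) * Y' i j k‖ ^ 2 ≤
            c * (Fintype.card ι : ℝ) ^ ((3 : ℝ) / 2 - δ) *
              ∑ i, ∑ j, ∑ k, ‖∑ l, A i l * B j l * C k l‖ ^ 2) →
        δ ≤ 3 / 2 - Real.logb (Fintype.card β) (∑ i, ∑ j, ∑ k, ‖Y i j k‖ ^ 2) :=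
  fun _ _ _ _ hcard h01 hflat hcl hpos _ _ h =>
    NonnegFlatTightness.delta_le_of_point h h01 hflat hcl hcard hpos

/-- **Registered sub-goal `nonnegFlatDecay_false_of_maxMassPoint` (def-free): THE EXACT-KILL CRITERION of the open stub.**
If some finite format `β` (`|β| ≥ 2`) carries a `0/1` flat tensor of maximal mass `‖Y‖² = |β|^{3/2}` lying in the closure of the
open `GL³`-orbit of the unit tensor (border rank `≤ |β|`), then `stub_nonnegFlatDecay` is false. -/
theorem nonnegFlatDecay_false_of_maxMassPoint :
    (∃ (β : Type) (_ : Fintype β) (_ : DecidableEq β) (Y : β → β → β → ℂ), 2 ≤ Fintype.card β ∧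
      (∀ i j k, Y i j k = 0 ∨ Y i j k = 1) ∧
      (∀ w u v : β → ℂ, ‖∑ i, ∑ j, ∑ k, w i * u j * v k * Y i j k‖ ≤
        Real.sqrt (∑ i, ‖w i‖ ^ 2) * Real.sqrt (∑ j, ‖u j‖ ^ 2) * Real.sqrt (∑ k, ‖v k‖ ^ 2)) ∧
      Y ∈ closure {S' : β → β → β → ℂ | ∃ A B C : Matrix β β ℂ,
        IsUnit A.det ∧ IsUnit B.det ∧ IsUnit C.det ∧ S' = fun a b c => ∑ l, A a l * B b l * C c l} ∧
      (∑ i, ∑ j, ∑ k, ‖Y i j k‖ ^ 2) = (Fintype.card β : ℝ) ^ ((3 : ℝ) / 2)) →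
    ¬ ∃ c δ : ℝ, 0 < δ ∧ ∀ (ι : Type) [Fintype ι] [DecidableEq ι] (Y' : ι → ι → ι → ℂ),
        (∀ i j k, ∃ t : ℝ, 0 ≤ t ∧ Y' i j k = t) →
        (∀ w u v : ι → ℂ, ‖∑ i, ∑ j, ∑ k, w i * u j * v k * Y' i j k‖ ≤
          Real.sqrt (∑ i, ‖w i‖ ^ 2) * Real.sqrt (∑ j, ‖u j‖ ^ 2) * Real.sqrt (∑ k, ‖v k‖ ^ 2)) →
        ∀ (A B C : Matrix ι ι ℂ), IsUnit A.det → IsUnit B.det → IsUnit C.det →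
          ‖∑ i, ∑ j, ∑ k, (∑ l, A i l * B j l * C k l) * Y' i j k‖ ^ 2 ≤
            c * (Fintype.card ι : ℝ) ^ ((3 : ℝ) / 2 - δ) *
              ∑ i, ∑ j, ∑ k, ‖∑ l, A i l * B j l * C k l‖ ^ 2 := by
  rintro ⟨β, _, _, Y, hcard, h01, hflat, hcl, hmass⟩ ⟨c, δ, hδ, h⟩
  exact NonnegFlatTightness.not_body_of_maxMassPoint h01 hflat hcl hcard hmass hδ h

end Summit.MatrixMultiplication.MatrixMultiplication.Theorems.DiagonalPowerDecay

end
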